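import Summits.BirchSwinnertonDyer.BirchSwinnertonDyer.Theorems.ThetaPartnerAtTwoMazurTateCongruenceAtTwoRDepletedTableConjugates
import HarnessLib

/-!
# Crux `MazurTateCongruenceAtTwoTop` (stmt-BirchSwinnertonDyer-25797 = `MazurTateCongruenceAtTwoR` 21416), K1 row of route
# `ThetaPartnerAtTwo`: the symbol-`μ` statement `Hμ` from DEPLETION-INJECTIVITY MOD 2 — an Ihara-shaped hypothesis;
# no `μ = 0`, no FLAT, no (PR₂), no `CuspSpanEvenAtTwo`
# (width seat bsd-wall-tp2-p1-w2 g3; `--supports stmt-BirchSwinnertonDyer-25797`; closes nothing)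

HONEST FRAMING. THEOREMS ONLY. The period fact `realPeriodRat_eq_unit_mul_plusPeriod_two` and the depletion-injectivity statement
(DI) are explicit HYPOTHESES; nothing about their truth is asserted; BSD is not proved by any of this.

WHAT. The K1 chain proves the crux BY NAME from four print facts, the period fact and `Hμ` (`mazurTateCongruenceAtTwoTop_of_fourFacts_mu`,
p622986); `Hμ` was so far discharged from the conjecture-grade node «`CuspSpanEvenAtTwo N` at every odd `N`» (p621042). But `Hμ(E)` only
says: the `S₀`-DEPLETED Néron-normalised plus table of `E` still has a value of `2`-adic norm `2` on `ℚ` — the UNDEPLETED table always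
does (`exists_ratPlusSymbol_maninCusp_eq_one_half`). Here `Hμ` is derived from the period fact and

  (DI)  for `E` good supersingular at `2` with `a₂(E) = 0`, a finite set `S₀` of odd places and every additive `χ : Γ₀(N_E) → ZMod 2`
        through the period functionals which is NOT `ψ ∘ (lower-right entry)`: some `γ ∈ Γ₀(N_E·∏_{v∈S₀} q_v²)` has
        `Σ_{k∈{0,1,2}^{S₀}} (∏_v c̄oeff_{k_v}(P_v(E)))·χ(diag(t_k,1)γdiag(t_k,1)⁻¹) ≠ 0`, `t_k = ∏_v q_v^{k_v}` (`Gamma0.degeneracyConjElt`),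

i.e. the mod-`2` depletion operator `D = ∏_v (1 + ā_v[q_v] + 𝟙_{good}[q_v²])` does not kill `χ` — Ihara's lemma read mod `2`
(injectivity of the old-class maps on the non-Eisenstein part of `J₀[2]`; Ribet 1984 Thm. 4.1 is coefficient-free, the three-copy and
`q ∥ N` statements of Darmon–Diamond–Taylor 1995 §4.5 / Lemma 4.28 (b) are printed for odd residue characteristic). Greenberg–Vatsal
transport needs `μ` to be a RESIDUAL INVARIANT, never `μ = 0`; on this road the K1 residue is (DI).

* §1 `symbolMu_of_depletionInjective (h2) (hDI)` — `Hμ` VERBATIM (the lead's `∀ E` shape): at the mod-`2` Manin character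
  `χ̄_f = (2re{∞,·∞}_f/Ω⁺_f mod 2)` (additive, through the period functionals, not `ψ∘d` by `SignedMuAtTwo.not_factorsThroughLowerRight`
  with `T₂`, `a₂ = 0`) take the `γ` of (DI); by `…RDepletedTableConjugates` `Ψ^{S₀}(γx) − Ψ^{S₀}(x) = ½Σ_k C_k m_{δ_k}` has norm `2`
  (`(2∏q_v²)·` it is an odd integer), all values have norm `≤ 2`, so one of the two points carries norm `2`; `‖ϖ‖₂ = 1`.
* §2 THE CRUX BY NAME: `mazurTateCongruenceAtTwoTop_of_fourFacts_depletionInjective (hES hSD hBz hSe) (h2) (hDI)`,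
  `…_of_fiveFacts_…` (Abbes–Ullmo: the bundle is the route's HOLD item `PublishedInputsHeckeAtTwo` 27435), the 21416 twin.

References: [GreenbergVatsal2000] Thm. (1.4), §3 (13), Remark 3.4; [Ribet1984ICM] Thm. 4.1; [DarmonDiamondTaylor1995] Lemma 4.28, 4.30,
§4.5 p. 137; [CremonaAlgorithms1997] §2.4, §2.8; [Manin1972] Thm. 1.9.
-/

-- justification: the `Summit.BirchSwinnertonDyer.BirchSwinnertonDyer.…` path repeats a component (route-file convention)
set_option linter.dupNamespace false
set_option autoImplicit false

noncomputable section

open scoped Classical MatrixGroups ModularForm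

open CongruenceSubgroup Polynomial WeierstrassCurve NumberField IsDedekindDomain
  Literature.NumberTheory.IwasawaTheory Literature.NumberTheory.EllipticCurves Literature.NumberTheory.EllipticCurves.ModularForms
  Literature.NumberTheory.EllipticCurves.Rank1Residual Literature.NumberTheory.EllipticCurves.GreenbergVatsal2000
  Summit.BirchSwinnertonDyer.Rank1Residual.Supersingular
  Summit.BirchSwinnertonDyer.BirchSwinnertonDyer.Theorems.ThetaLayerLambdaCongruenceAtTwo

namespace Summit.BirchSwinnertonDyer.BirchSwinnertonDyer.Theorems.MazurTateCongruenceAtTwoR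

/-! ## §1. `Hμ` from depletion-injectivity mod `2` and the period fact -/

section SymbolMu

/-- **`Hμ` FROM DEPLETION-INJECTIVITY MOD 2 (DI) — no `μ = 0`, no FLAT, no (PR₂), no `CuspSpanEvenAtTwo`.** `Hμ` is the lead's
`∀ E` symbol-`μ` statement verbatim (hypothesis of `mazurTateCongruenceAtTwoTop_of_fourFacts_mu`): for every globally minimal `E`
good supersingular at `2` with `a₂(E) = 0`, newform `f`, Néron ratio `ϖ` and finite set `S₀` of odd places, the expanded `S₀`-depleted
plus table attains its maximal `2`-adic norm over `ℚ` at some `x₀` with `‖2ϖ·Ψ^{S₀}(x₀)‖ = 1`. HYPOTHESES: the period fact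
`realPeriodRat_eq_unit_mul_plusPeriod_two` (`‖ϖ‖₂ = 1`) and (DI): for every such `E`, `S₀` and every additive `χ : Γ₀(N_E) → ZMod 2`
through the period functionals which is NOT `ψ ∘ (lower-right entry)` for a `ψ` multiplicative on units, some `γ ∈ Γ₀(N_E·∏ q_v²)`
has `Σ_k (∏_v c̄oeff_{k_v}(P_v))·χ(diag(t_k,1)γdiag(t_k,1)⁻¹) ≠ 0` — the mod-`2` depletion operator does not kill `χ`
(= Ihara's lemma read mod `2`: injectivity of the old-class maps on the non-Eisenstein part of `J₀(N_E)[2]`; Ribet 1984 Thm. 4.1 for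
one degeneracy step, the three-copy / `q ∥ N` statements of Darmon–Diamond–Taylor §4.5 for the others). PROOF: the mod-`2` Manin
character `χ̄_f = (2re{∞,·∞}_f/Ω⁺_f mod 2)` is additive, through the period functionals and not `ψ∘d`
(`SignedMuAtTwo.not_factorsThroughLowerRight`, witness `T₂`, `a₂ = 0`); at the `γ` given by (DI) and a point `x` with `cx + d ≠ 0`,
`Ψ^{S₀}(γx) − Ψ^{S₀}(x) = ½Σ_k C_k m_{δ_k}` (§2) has norm `2` because `(2∏q_v²)·` it is an ODD integer (its class mod `2` is the
(DI) sum); all values have norm `≤ 2` (`norm_depletedCurveSymbol_le_of_forall_le`, `norm_ratPlusSymbol_le_two`), so `Ψ^{S₀}(γx)` or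
`Ψ^{S₀}(x)` has norm exactly `2` (ultrametric); `‖ϖ‖₂ = 1` (`norm_ratCast_periodRatio_eq_one_two`). BSD is not proved by this.
[cite: GreenbergVatsal2000, §3 (13) and Remark 3.4] [cite: Ribet1984ICM, Thm. 4.1] [cite: DarmonDiamondTaylor1995, Lemma 4.28 and §4.5 p. 137]
[cite: CremonaAlgorithms1997, §2.4, §2.8] -/
theorem symbolMu_of_depletionInjective (h2 : realPeriodRat_eq_unit_mul_plusPeriod_two)
    (hDI : ∀ (E : WeierstrassCurve ℚ) [E.IsElliptic] [E.IsGloballyMinimal], GoodSS E 2 → E.frobeniusTrace 2 = 0 →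
      ∀ [NeZero (E.conductorNorm ℤ)] (S₀ : Finset (HeightOneSpectrum (𝓞 ℚ))), (∀ v ∈ S₀, ((2 : ℕ) : 𝓞 ℚ) ∉ v.asIdeal) →
      ∀ χ : Gamma0 (E.conductorNorm ℤ) → ZMod 2,
        (∀ γ δ : Gamma0 (E.conductorNorm ℤ), χ (γ * δ) = χ γ + χ δ) →
        (∀ γ δ : Gamma0 (E.conductorNorm ℤ),
          periodFunctional (E.conductorNorm ℤ) γ = periodFunctional (E.conductorNorm ℤ) δ → χ γ = χ δ) →
        (¬ ∃ ψ : ZMod (E.conductorNorm ℤ) → ZMod 2,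
            (∀ x y : ZMod (E.conductorNorm ℤ), IsUnit x → IsUnit y → ψ (x * y) = ψ x + ψ y) ∧
            ∀ γ : Gamma0 (E.conductorNorm ℤ), χ γ = ψ ((((γ : SL(2, ℤ)) 1 1 : ℤ) : ZMod (E.conductorNorm ℤ)))) →
        ∃ γ : Gamma0 (E.conductorNorm ℤ * ∏ v : S₀, Rat.HeightOneSpectrum.natGenerator (v : HeightOneSpectrum (𝓞 ℚ)) ^ 2),
          (∑ k ∈ Fintype.piFinset (fun _ : S₀ ↦ Finset.range 3),
            if h : E.conductorNorm ℤ * ∏ v : S₀, Rat.HeightOneSpectrum.natGenerator (v : HeightOneSpectrum (𝓞 ℚ)) ^ (k v) ∣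
                E.conductorNorm ℤ * ∏ v : S₀, Rat.HeightOneSpectrum.natGenerator (v : HeightOneSpectrum (𝓞 ℚ)) ^ 2 then
              (∏ v : S₀, ((E.localPolynomialAt (v : HeightOneSpectrum (𝓞 ℚ))).map (Int.castRingHom (ZMod 2))).coeff (k v)) *
                χ (Gamma0.degeneracyConjElt h γ)
            else 0) ≠ 0) :
    ∀ (E : WeierstrassCurve ℚ) [E.IsElliptic] [E.IsGloballyMinimal], GoodSS E 2 → E.frobeniusTrace 2 = 0 →
      ∀ [NeZero (E.conductorNorm ℤ)] (f : CuspForm (Gamma0 (E.conductorNorm ℤ)) 2), IsNewformOf E f →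
      ∀ (ϖ : ℚ), (ϖ : ℝ) * E.realPeriodRat = plusPeriod f →
      ∀ (S₀ : Finset (HeightOneSpectrum (𝓞 ℚ))), (∀ v ∈ S₀, ((2 : ℕ) : 𝓞 ℚ) ∉ v.asIdeal) →
        (∀ v : HeightOneSpectrum (𝓞 ℚ), ¬ E.HasGoodReductionAt v → v ∈ S₀) →
      ∃ x₀ : ℚ, (∀ r : ℚ, ‖(∑ k ∈ Fintype.piFinset (fun _ : S₀ ↦ Finset.range 3), (∏ v : S₀, ((E.localPolynomialAt (v : HeightOneSpectrum (𝓞 ℚ))).map (Int.castRingHom (PadicAlgCl 2))).coeff (k v) * ((Rat.HeightOneSpectrum.natGenerator (v : HeightOneSpectrum (𝓞 ℚ)) : PadicAlgCl 2)⁻¹) ^ (k v)) * algebraMap ℚ (PadicAlgCl 2) (ratPlusSymbol f (r * ((∏ v : S₀, Rat.HeightOneSpectrum.natGenerator (v : HeightOneSpectrum (𝓞 ℚ)) ^ (k v) : ℕ) : ℚ))))‖ ≤ ‖(∑ k ∈ Fintype.piFinset (fun _ : S₀ ↦ Finset.range 3), (∏ v : S₀, ((E.localPolynomialAt (v : HeightOneSpectrum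 (𝓞 ℚ))).map (Int.castRingHom (PadicAlgCl 2))).coeff (k v) * ((Rat.HeightOneSpectrum.natGenerator (v : HeightOneSpectrum (𝓞 ℚ)) : PadicAlgCl 2)⁻¹) ^ (k v)) * algebraMap ℚ (PadicAlgCl 2) (ratPlusSymbol f (x₀ * ((∏ v : S₀, Rat.HeightOneSpectrum.natGenerator (v : HeightOneSpectrum (𝓞 ℚ)) ^ (k v) : ℕ) : ℚ))))‖) ∧
        ‖algebraMap ℚ (PadicAlgCl 2) (2 * ϖ) * (∑ k ∈ Fintype.piFinset (fun _ : S₀ ↦ Finset.range 3), (∏ v : S₀, ((E.localPolynomialAt (v : HeightOneSpectrum (𝓞 ℚ))).map (Int.castRingHom (PadicAlgCl 2))).coeff (k v) * ((Rat.HeightOneSpectrum.natGenerator (v : HeightOneSpectrum (𝓞 ℚ)) : PadicAlgCl 2)⁻¹) ^ (k v)) * algebraMap ℚ (PadicAlgCl 2) (ratPlusSymbol f (x₀ * ((∏ v : S₀, Rat.HeightOneSpectrum.natGenerator (v : HeightOneSpectrum (𝓞 ℚ)) ^ (k v) : ℕ) : ℚ))))‖ = 1 := by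
  intro E _ _ hss ha _ f hf ϖ hϖ S₀ hS2 _
  have hf0 : IsNewform0 f := hf.1
  have hQ : coeffField f = ⊥ := hf.coeffField_eq_bot
  have hΩ : plusPeriod f ≠ 0 := (IsNewform0.plusPeriod_pos_holds hf0 hQ).ne'
  have h2N : ¬ 2 ∣ E.conductorNorm ℤ := SignedMuAtTwo.not_two_dvd_conductorNorm_of_goodSS hss
  have hT : heckeT (Gamma0 (E.conductorNorm ℤ)) 2 2 f = ((0 : ℤ) : ℂ) • f :=
    SignedMuAtTwo.heckeT_two_eq_zero_smul_of_isNewformOf hf hss ha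
  -- the doubled plus periods `m δ`: the mod-2 Manin character is `(m δ) mod 2`
  choose m hm using SignedMuAtTwo.exists_int_re_cuspSymbol_eq f hΩ
  have hmul : ∀ γ δ : Gamma0 (E.conductorNorm ℤ), m (γ * δ) = m γ + m δ := by
    intro γ δ
    apply SignedMuAtTwo.int_eq_of_mul_plusPeriod_half_eq f hΩ
    have h := congrArg Complex.re (cuspSymbol_mul_holds f γ δ)
    rw [Complex.add_re, hm, hm, hm] at h
    rw [h]; push_cast; ring
  have hfac : ∀ γ δ : Gamma0 (E.conductorNorm ℤ),
      periodFunctional (E.conductorNorm ℤ) γ = periodFunctional (E.conductorNorm ℤ) δ → m γ = m δ := by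
    intro γ δ h
    apply SignedMuAtTwo.int_eq_of_mul_plusPeriod_half_eq f hΩ
    rw [← hm, ← hm, ← periodFunctional_apply (E.conductorNorm ℤ) γ f, ← periodFunctional_apply (E.conductorNorm ℤ) δ f, h]
  have hnE : ¬ ∃ ψ : ZMod (E.conductorNorm ℤ) → ZMod 2,
      (∀ x y : ZMod (E.conductorNorm ℤ), IsUnit x → IsUnit y → ψ (x * y) = ψ x + ψ y) ∧
      ∀ γ : Gamma0 (E.conductorNorm ℤ), ((m γ : ℤ) : ZMod 2) = ψ ((((γ : SL(2, ℤ)) 1 1 : ℤ) : ZMod (E.conductorNorm ℤ))) := by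
    rintro ⟨ψ, hψ, hχψ⟩
    refine SignedMuAtTwo.not_factorsThroughLowerRight f hΩ Nat.prime_two h2N hT (by decide) ψ hψ fun γ n hn ↦ ?_
    have : n = m γ := SignedMuAtTwo.int_eq_of_mul_plusPeriod_half_eq f hΩ (by rw [← hn, hm])
    rw [this]
    exact hχψ γ
  -- (DI) at the mod-2 Manin character
  obtain ⟨γ, hγ⟩ := hDI E hss ha S₀ hS2 (fun δ ↦ ((m δ : ℤ) : ZMod 2))
    (fun γ δ ↦ by simp only [hmul]; push_cast; rfl) (fun γ δ h ↦ by simp only [hfac γ δ h]) hnE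
  -- the integers `μ k = m(δ_k)` along the conjugates `δ_k = diag(t_k,1)γdiag(t_k,1)⁻¹`
  set μ : (S₀ → ℕ) → ℤ := fun k ↦
    if h : E.conductorNorm ℤ * ∏ v : S₀, Rat.HeightOneSpectrum.natGenerator (v : HeightOneSpectrum (𝓞 ℚ)) ^ (k v) ∣
        E.conductorNorm ℤ * ∏ v : S₀, Rat.HeightOneSpectrum.natGenerator (v : HeightOneSpectrum (𝓞 ℚ)) ^ 2 then
      m (Gamma0.degeneracyConjElt h γ) else 0 with hμdef
  have hμ : ∀ (k : S₀ → ℕ) (hk : k ∈ Fintype.piFinset fun _ : S₀ ↦ Finset.range 3),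
      μ k = m (Gamma0.degeneracyConjElt (mul_prod_pow_dvd_mul_prod_sq S₀ hk) γ) := by
    intro k hk
    simp only [hμdef, dif_pos (mul_prod_pow_dvd_mul_prod_sq S₀ hk)]
  have hμm : ∀ (k : S₀ → ℕ) (hk : k ∈ Fintype.piFinset fun _ : S₀ ↦ Finset.range 3),
      (cuspSymbol f (Gamma0.degeneracyConjElt (mul_prod_pow_dvd_mul_prod_sq S₀ hk) γ)).re = μ k * (plusPeriod f / 2) := by
    intro k hk
    rw [hμ k hk]
    exact hm _
  -- the (DI) sum is the class mod 2 of the integer `R`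
  have hγ' : (∑ k ∈ Fintype.piFinset (fun _ : S₀ ↦ Finset.range 3),
      (∏ v : S₀, ((E.localPolynomialAt (v : HeightOneSpectrum (𝓞 ℚ))).map (Int.castRingHom (ZMod 2))).coeff (k v)) *
        ((μ k : ℤ) : ZMod 2)) ≠ 0 := by
    refine fun h0 ↦ hγ ?_
    rw [← h0]
    refine Finset.sum_congr rfl fun k hk ↦ ?_
    rw [dif_pos (mul_prod_pow_dvd_mul_prod_sq S₀ hk), hμ k hk]
  have hR2 := (intCast_sum_depletionCoeff_mul_zmod_two E S₀ hS2 μ).trans_ne hγ'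
  have hRodd := odd_of_intCast_zmod_two_ne_zero hR2
  have hR1 := norm_intCast_padicAlgCl_two_eq_one_of_odd hRodd
  -- `c(γ) ≠ 0` (otherwise every `δ_k` is upper triangular and every `m(δ_k) = 0`)
  have hc : (γ : SL(2, ℤ)) 1 0 ≠ 0 := by
    intro h0
    apply hγ'
    refine Finset.sum_eq_zero fun k hk ↦ ?_
    have hμ0 : μ k = 0 := by
      rw [hμ k hk]
      apply SignedMuAtTwo.int_eq_of_mul_plusPeriod_half_eq f hΩ
      rw [← hm]
      have : cuspSymbol f (Gamma0.degeneracyConjElt (mul_prod_pow_dvd_mul_prod_sq S₀ hk) γ) = 0 := by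
        unfold cuspSymbol
        rw [if_pos]
        rw [Gamma0.degeneracyConjElt_apply_one_zero, h0, Int.zero_ediv]
      rw [this, Complex.zero_re]
      push_cast
      ring
    rw [hμ0]
    push_cast
    ring
  -- a point `x` with `cx + d ≠ 0`
  obtain ⟨x, hx⟩ : ∃ x : ℚ, ((γ : SL(2, ℤ)) 1 0 : ℚ) * x + ((γ : SL(2, ℤ)) 1 1 : ℚ) ≠ 0 := by
    by_cases hd : (γ : SL(2, ℤ)) 1 1 = 0
    · refine ⟨1, ?_⟩
      rw [hd, mul_one, Int.cast_zero, add_zero]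
      exact_mod_cast hc
    · refine ⟨0, ?_⟩
      rw [mul_zero, zero_add]
      exact_mod_cast hd
  -- every depleted value has norm `≤ 2`
  have hbound := fun r : ℚ ↦ norm_depletedCurveSymbol_le_of_forall_le E f S₀ hS2
    (fun r ↦ norm_ratPlusSymbol_le_two hf hss ha r) r
  -- the difference along `γ` has norm `2`
  have hdiff := depletedTable_gamma0_smul E f S₀ hf0 hQ γ hc x hx μ hμm
  have hB := two_mul_prod_sq_mul_sum_depletionCoeff_eq_intCast E S₀ μ
  have hQn : ‖((2 * ∏ v : S₀, Rat.HeightOneSpectrum.natGenerator (v : HeightOneSpectrum (𝓞 ℚ)) ^ 2 : ℕ) : PadicAlgCl 2)‖ = 2⁻¹ := by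
    push_cast
    rw [norm_mul, ResidualThetaLayer.norm_two_padicAlgCl, norm_prod, Finset.prod_eq_one, mul_one]
    intro v _
    rw [norm_pow, norm_natCast_padicAlgCl_two_eq_one (not_two_dvd_natGenerator (hS2 v v.2)), one_pow]
  have hSn := norm_eq_two_of_mul_eq hB hQn hR1
  have hge := two_le_norm_or_of_eq_add hdiff hSn
  -- `‖ϖ‖₂ = 1`
  have hϖ1 : ‖algebraMap ℚ (PadicAlgCl 2) ϖ‖ = 1 := by
    rw [norm_algebraMap_rat_eq_norm_ratCast_padic]
    exact norm_ratCast_periodRatio_eq_one_two h2 E hss hf hϖ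
  rcases hge with h | h
  · refine ⟨((((γ : SL(2, ℤ)) 0 0 : ℚ) * x + ((γ : SL(2, ℤ)) 0 1 : ℚ)) /
      (((γ : SL(2, ℤ)) 1 0 : ℚ) * x + ((γ : SL(2, ℤ)) 1 1 : ℚ))), fun r ↦ (hbound r).trans h, ?_⟩
    rw [norm_mul, le_antisymm (hbound _) h, map_mul, norm_mul, hϖ1, map_ofNat, ResidualThetaLayer.norm_two_padicAlgCl]
    norm_num
  · refine ⟨x, fun r ↦ (hbound r).trans h, ?_⟩
    rw [norm_mul, le_antisymm (hbound _) h, map_mul, norm_mul, hϖ1, map_ofNat, ResidualThetaLayer.norm_two_padicAlgCl]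
    norm_num

end SymbolMu

/-! ## §2. THE CRUX BY NAME behind four / five print facts and depletion-injectivity mod `2` -/

section Crux

/-- **THE CRUX `MazurTateCongruenceAtTwoTop` (stmt-25797) BY NAME behind FOUR print facts + the period fact + (DI)** — the K1 chain
`mazurTateCongruenceAtTwoTop_of_fourFacts_mu` (p622986) fed with `symbolMu_of_depletionInjective`: no `μ = 0` statement, no
`CuspSpanEvenAtTwo`, no FLAT / (PR₂) anywhere. Conditional on the named facts and on (DI) (Ihara-shaped, print-adjacent); BSD is not
proved by this. [cite: GreenbergVatsal2000, Thm. (1.4), §3 (13) and Remark 3.4] [cite: Ribet1984ICM, Thm. 4.1]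
[cite: Buzzard2000LevelLoweringModTwo, Prop. 2.4] -/
theorem mazurTateCongruenceAtTwoTop_of_fourFacts_depletionInjective
    (hES : eichlerShimura_depletedOptimalQuotient_periodLattice_of_dvd) (hSD : heckeSelfDual_torsionBy_J0)
    (hBz : buzzard2000_multiplicityOne_gamma0) (hSe : serre1972_supersingular_decompositionSubgroup_image)
    (h2 : realPeriodRat_eq_unit_mul_plusPeriod_two)
    (hDI : ∀ (E : WeierstrassCurve ℚ) [E.IsElliptic] [E.IsGloballyMinimal], GoodSS E 2 → E.frobeniusTrace 2 = 0 →
      ∀ [NeZero (E.conductorNorm ℤ)] (S₀ : Finset (HeightOneSpectrum (𝓞 ℚ))), (∀ v ∈ S₀, ((2 : ℕ) : 𝓞 ℚ) ∉ v.asIdeal) →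
      ∀ χ : Gamma0 (E.conductorNorm ℤ) → ZMod 2,
        (∀ γ δ : Gamma0 (E.conductorNorm ℤ), χ (γ * δ) = χ γ + χ δ) →
        (∀ γ δ : Gamma0 (E.conductorNorm ℤ),
          periodFunctional (E.conductorNorm ℤ) γ = periodFunctional (E.conductorNorm ℤ) δ → χ γ = χ δ) →
        (¬ ∃ ψ : ZMod (E.conductorNorm ℤ) → ZMod 2,
            (∀ x y : ZMod (E.conductorNorm ℤ), IsUnit x → IsUnit y → ψ (x * y) = ψ x + ψ y) ∧
            ∀ γ : Gamma0 (E.conductorNorm ℤ), χ γ = ψ ((((γ : SL(2, ℤ)) 1 1 : ℤ) : ZMod (E.conductorNorm ℤ)))) →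
        ∃ γ : Gamma0 (E.conductorNorm ℤ * ∏ v : S₀, Rat.HeightOneSpectrum.natGenerator (v : HeightOneSpectrum (𝓞 ℚ)) ^ 2),
          (∑ k ∈ Fintype.piFinset (fun _ : S₀ ↦ Finset.range 3),
            if h : E.conductorNorm ℤ * ∏ v : S₀, Rat.HeightOneSpectrum.natGenerator (v : HeightOneSpectrum (𝓞 ℚ)) ^ (k v) ∣
                E.conductorNorm ℤ * ∏ v : S₀, Rat.HeightOneSpectrum.natGenerator (v : HeightOneSpectrum (𝓞 ℚ)) ^ 2 then
              (∏ v : S₀, ((E.localPolynomialAt (v : HeightOneSpectrum (𝓞 ℚ))).map (Int.castRingHom (ZMod 2))).coeff (k v)) *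
                χ (Gamma0.degeneracyConjElt h γ)
            else 0) ≠ 0) :
    Summit.BirchSwinnertonDyer.BirchSwinnertonDyer.Theses.ThetaPartnerAtTwo.MazurTateCongruenceAtTwoTop :=
  mazurTateCongruenceAtTwoTop_of_fourFacts_mu hES hSD hBz hSe (symbolMu_of_depletionInjective h2 hDI)

/-- **THE CRUX BY NAME behind PUB⁵ + (DI)**: the period fact from Abbes–Ullmo Thm A
(`SkinnerUrban2014.realPeriodRat_eq_unit_mul_plusPeriod_two_fact_of_abbesUllmo`), so the print bundle is exactly the route's HOLD item
`PublishedInputsHeckeAtTwo` (27435) = {ES-depleted, SD, Bz, Se, AU}. BSD is not proved by this. [cite: AbbesUllmo1996, Thm. A]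
[cite: Ribet1984ICM, Thm. 4.1] [cite: GreenbergVatsal2000, §3 (13) and Remark 3.4] -/
theorem mazurTateCongruenceAtTwoTop_of_fiveFacts_depletionInjective
    (hES : eichlerShimura_depletedOptimalQuotient_periodLattice_of_dvd) (hSD : heckeSelfDual_torsionBy_J0)
    (hBz : buzzard2000_multiplicityOne_gamma0) (hSe : serre1972_supersingular_decompositionSubgroup_image)
    (hAU : abbesUllmo_not_dvd_maninConstant_of_not_dvd_level)
    (hDI : ∀ (E : WeierstrassCurve ℚ) [E.IsElliptic] [E.IsGloballyMinimal], GoodSS E 2 → E.frobeniusTrace 2 = 0 →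
      ∀ [NeZero (E.conductorNorm ℤ)] (S₀ : Finset (HeightOneSpectrum (𝓞 ℚ))), (∀ v ∈ S₀, ((2 : ℕ) : 𝓞 ℚ) ∉ v.asIdeal) →
      ∀ χ : Gamma0 (E.conductorNorm ℤ) → ZMod 2,
        (∀ γ δ : Gamma0 (E.conductorNorm ℤ), χ (γ * δ) = χ γ + χ δ) →
        (∀ γ δ : Gamma0 (E.conductorNorm ℤ),
          periodFunctional (E.conductorNorm ℤ) γ = periodFunctional (E.conductorNorm ℤ) δ → χ γ = χ δ) →
        (¬ ∃ ψ : ZMod (E.conductorNorm ℤ) → ZMod 2,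
            (∀ x y : ZMod (E.conductorNorm ℤ), IsUnit x → IsUnit y → ψ (x * y) = ψ x + ψ y) ∧
            ∀ γ : Gamma0 (E.conductorNorm ℤ), χ γ = ψ ((((γ : SL(2, ℤ)) 1 1 : ℤ) : ZMod (E.conductorNorm ℤ)))) →
        ∃ γ : Gamma0 (E.conductorNorm ℤ * ∏ v : S₀, Rat.HeightOneSpectrum.natGenerator (v : HeightOneSpectrum (𝓞 ℚ)) ^ 2),
          (∑ k ∈ Fintype.piFinset (fun _ : S₀ ↦ Finset.range 3),
            if h : E.conductorNorm ℤ * ∏ v : S₀, Rat.HeightOneSpectrum.natGenerator (v : HeightOneSpectrum (𝓞 ℚ)) ^ (k v) ∣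
                E.conductorNorm ℤ * ∏ v : S₀, Rat.HeightOneSpectrum.natGenerator (v : HeightOneSpectrum (𝓞 ℚ)) ^ 2 then
              (∏ v : S₀, ((E.localPolynomialAt (v : HeightOneSpectrum (𝓞 ℚ))).map (Int.castRingHom (ZMod 2))).coeff (k v)) *
                χ (Gamma0.degeneracyConjElt h γ)
            else 0) ≠ 0) :
    Summit.BirchSwinnertonDyer.BirchSwinnertonDyer.Theses.ThetaPartnerAtTwo.MazurTateCongruenceAtTwoTop :=
  mazurTateCongruenceAtTwoTop_of_fourFacts_depletionInjective hES hSD hBz hSe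
    (SkinnerUrban2014.realPeriodRat_eq_unit_mul_plusPeriod_two_fact_of_abbesUllmo hAU) hDI

/-- The twin `MazurTateCongruenceAtTwoR` (stmt-21416) BY NAME behind four print facts + the period fact + (DI) (the two decls are
definitionally equal). BSD is not proved by this. [cite: GreenbergVatsal2000, §3 (13)] [cite: Ribet1984ICM, Thm. 4.1] -/
theorem mazurTateCongruenceAtTwoR_of_fourFacts_depletionInjective
    (hES : eichlerShimura_depletedOptimalQuotient_periodLattice_of_dvd) (hSD : heckeSelfDual_torsionBy_J0)
    (hBz : buzzard2000_multiplicityOne_gamma0) (hSe : serre1972_supersingular_decompositionSubgroup_image)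
    (h2 : realPeriodRat_eq_unit_mul_plusPeriod_two)
    (hDI : ∀ (E : WeierstrassCurve ℚ) [E.IsElliptic] [E.IsGloballyMinimal], GoodSS E 2 → E.frobeniusTrace 2 = 0 →
      ∀ [NeZero (E.conductorNorm ℤ)] (S₀ : Finset (HeightOneSpectrum (𝓞 ℚ))), (∀ v ∈ S₀, ((2 : ℕ) : 𝓞 ℚ) ∉ v.asIdeal) →
      ∀ χ : Gamma0 (E.conductorNorm ℤ) → ZMod 2,
        (∀ γ δ : Gamma0 (E.conductorNorm ℤ), χ (γ * δ) = χ γ + χ δ) →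
        (∀ γ δ : Gamma0 (E.conductorNorm ℤ),
          periodFunctional (E.conductorNorm ℤ) γ = periodFunctional (E.conductorNorm ℤ) δ → χ γ = χ δ) →
        (¬ ∃ ψ : ZMod (E.conductorNorm ℤ) → ZMod 2,
            (∀ x y : ZMod (E.conductorNorm ℤ), IsUnit x → IsUnit y → ψ (x * y) = ψ x + ψ y) ∧
            ∀ γ : Gamma0 (E.conductorNorm ℤ), χ γ = ψ ((((γ : SL(2, ℤ)) 1 1 : ℤ) : ZMod (E.conductorNorm ℤ)))) →
        ∃ γ : Gamma0 (E.conductorNorm ℤ * ∏ v : S₀, Rat.HeightOneSpectrum.natGenerator (v : HeightOneSpectrum (𝓞 ℚ)) ^ 2),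
          (∑ k ∈ Fintype.piFinset (fun _ : S₀ ↦ Finset.range 3),
            if h : E.conductorNorm ℤ * ∏ v : S₀, Rat.HeightOneSpectrum.natGenerator (v : HeightOneSpectrum (𝓞 ℚ)) ^ (k v) ∣
                E.conductorNorm ℤ * ∏ v : S₀, Rat.HeightOneSpectrum.natGenerator (v : HeightOneSpectrum (𝓞 ℚ)) ^ 2 then
              (∏ v : S₀, ((E.localPolynomialAt (v : HeightOneSpectrum (𝓞 ℚ))).map (Int.castRingHom (ZMod 2))).coeff (k v)) *
                χ (Gamma0.degeneracyConjElt h γ)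
            else 0) ≠ 0) :
    Summit.BirchSwinnertonDyer.BirchSwinnertonDyer.Theses.ThetaPartnerAtTwo.MazurTateCongruenceAtTwoR :=
  mazurTateCongruenceAtTwoTop_of_fourFacts_depletionInjective hES hSD hBz hSe h2 hDI

end Crux

end Summit.BirchSwinnertonDyer.BirchSwinnertonDyer.Theorems.MazurTateCongruenceAtTwoR

end
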